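import Literature.MathematicalPhysics.QuantumFieldTheory.Balaban1983to89.B5CombesThomasLatticeSolve

/-!
# `Balaban1983to89.B5Local114GLatticeFirst` — Bałaban CMP 95 (1984), Proposition 1.2, (1.114) FOR `G = Δ_a⁻¹` on the
# lattice torus of record: the four FIRST-ORDER entries `‖ζGJ‖, ‖ζ∇GJ‖, ‖ζG∇*J‖, ‖ζ∇G∇*J‖ ≤ O(1)e^{−δ₀|y−y′|}|ζ|‖J‖`
# from the weighted solves of `B5CombesThomasLatticeSolve` (UNDER the printed kernel bound (1.126) on `∂P∂*`)

statement-level skeleton of published theorems with citation tags; proofs where landed; nothing here is a claim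
about the Yang–Mills mass gap

Source (lit-balaban cell, Phase-2 proof seat p37 gen 7): T. Bałaban, *Propagators and renormalization transformations
for lattice gauge theories. I*, Commun. Math. Phys. **95** (1984) 17–40 [`Balaban1984PropagatorsI`, "B5"], Prop. 1.2
(1.114) p. 36 [PDF 20], p. 39 [PDF 23]; held as `paper:balaban1984-cmp95-propagators-rt-i`.  Unit `lit-balaban-p37`, HOME
`run/shared/lean/pub/lit-balaban/` (SKELETON row B5.Prop1.2, owner's census item (vi)-G).

## WHAT IS PRINTED (verbatim)

p. 36 [PDF 20], (1.114): «Finally there exists a constant O(1) such that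
  ‖ζGJ‖, ‖ζ∇GJ‖, ‖ζG∇*J‖, ‖ζ∇G∇*J‖, ‖ζ∇∇GJ‖, ‖ζG∇*∇*J‖ ≤ O(1)e^{−δ₀|y−y′|}|ζ| ‖J‖   (1.114)
for supp ζ ⊂ Δ̃(y), supp J ⊂ Δ̃(y′).»
p. 39 [PDF 23]: «Let us notice that the proof of inequalities (1.114), describing the decay in L²-norms, is completed because
we have proved inequalities (1.89).»

## WHAT THIS MODULE PROVES (kernel-checked, zero sorry)

In r02's presentation (`B5Prop12FieldsLattice`: `l2locL n M a m J ζ`, `smulV`/`smulT`, `cutInL`, `suppInL`-shaped support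
hypotheses, `cutSupL ζ = |ζ|`, unweighted `l2`/`l2T`), UNDER the hypothesis `h126` of `B5CombesThomasLatticeSolve` ((1.126) on
`dPd = GradOp·PcT·GradOpᴴ`), for `0 ≤ δ ≤ δ₁ = delta1 d a δ′ C`, `ζ` supported in `Δ̃(y)` and the source supported over `Δ̃(y′)`:
* `l2_smulV_G_le` (m = 0): `‖ζGJ‖ ≤ e^{2δ}(2e^δ/γ₀)·e^{−δ|y−y′|}|ζ|‖J‖`;
* `l2T_smulT_gradG_le` (m = 1): `‖ζ∇GJ‖ ≤ 3e^{2δ}√(2(d+1))(2e^δ/γ₀)·e^{−δ|y−y′|}|ζ|‖J‖`;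
* `l2_smulV_GdivT_le` (m = 2), `l2T_smulT_gradGdivT_le` (m = 3): the same for `G∇*J`, `∇G∇*J` with the divergence-source
  constant `√(72(d+1))e^δ/γ₀` of `solveDiv_bound`;
via the generic extraction lemmas `nsq_smulV_le_of_majorant` (cut-off against a pointwise majorant on `Δ̃(y)`),
`norm_G_le_on_cube` / `norm_gradG_le_on_cube` (the weight `e^{−δρ_{y′}} ≤ e^{2δ}e^{−δ|y−y′|}` on `Δ̃(y)`, product rule).

## HONEST SCOPE / DIVERGENCE

Method = the p. 36 alternative (Combes–Thomas on the torus), not the printed random walk — see `B5CombesThomasLattice`;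
(1.126) is the explicit hypothesis `h126`; constants ours.  The second-order entries `‖ζ∇∇GJ‖`, `‖ζG∇*∇*J‖` and the family
statement `B5.Local114Fam` are in the companion files `B5Local114GLatticeSecond`, `B5Local114GLattice`.  CELL BOOK-KEEPING
(lit-balaban): row B5.Prop1.2, census item (vi)-G (owner r02, referee ref-4); VALUE = four of the six entries of (1.114) for
G on the torus, kernel-checked modulo the printed leaf (1.126) — NOT summit progress.
-/

namespace Literature.MathematicalPhysics.QuantumFieldTheory.Balaban1983to89.B5Local114GLatticeFirst

open scoped BigOperators Matrix ComplexConjugate ComplexOrder Matrix.Norms.L2Operator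
open Finset Complex Matrix
open Literature.MathematicalPhysics.QuantumFieldTheory.Balaban1983to89.B5Prop11Plancherel (Tor fine fdiff shiftM unitVec)
open Literature.MathematicalPhysics.QuantumFieldTheory.Balaban1983to89.B5Prop11Lower (Lap nsq nsq_nonneg
  star_dotProduct_self form_gram)
open Literature.MathematicalPhysics.QuantumFieldTheory.Balaban1983to89.B5Prop11Lattice (gammaZero gammaZero_pos l2 l2T
  l2_nonneg l2T_nonneg grad divT)
open Literature.MathematicalPhysics.QuantumFieldTheory.Balaban1983to89.B5Prop12FieldsLattice (cdistF distU distSite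
  toFine cube1 cubeT distU_nonneg distSite_nonneg toFine_mem_cubeT smulV smulT cutInL cutSupL cutSupL_nonneg)
open Literature.MathematicalPhysics.QuantumFieldTheory.Balaban1983to89.B5DeltaA169 (DeltaA QvAdj isUnit_DeltaA
  DeltaA_mul_calG calG_eq_DeltaA_inv)
open Literature.MathematicalPhysics.QuantumFieldTheory.Balaban1983to89.B5Block118 (QvOp)
open Literature.MathematicalPhysics.QuantumFieldTheory.Balaban1983to89.LatticeNorms (supNorm norm_le_supNorm supNorm_nonneg)
open Literature.MathematicalPhysics.QuantumFieldTheory.Balaban1983to89.B5CombesThomasLattice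
open Literature.MathematicalPhysics.QuantumFieldTheory.Balaban1983to89.B5CombesThomasLatticeSolve

noncomputable section

variable {d : ℕ} (n : ℕ) [NeZero n] (M : Fin d → ℕ) [hM : ∀ μ, NeZero (M μ)]

/-! ## §1 `G = Δ_a⁻¹` solves (1.73); the cut-off against a pointwise majorant -/

/-- «Δ_a⁻¹ = G» (1.71): `Δ_a(GJ) = J`. [cite: Balaban1984PropagatorsI, (1.71) p.30, (1.73) p.30] -/
theorem DeltaA_mulVec_G (hn : 1 ≤ n) {a : ℝ} (ha : 0 < a) (f : Tor (fine n M) × Fin d → ℂ) :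
    DeltaA n M a *ᵥ ((DeltaA n M a)⁻¹ *ᵥ f) = f := by
  rw [Matrix.mulVec_mulVec, ← calG_eq_DeltaA_inv n hn M a ha, DeltaA_mul_calG n hn M a ha, Matrix.one_mulVec]

/-- **the cut-off against a majorant**: if `supp ζ ⊂ Δ̃(y)` and `‖u(i)‖ ≤ g(i)` for the bonds `i` over `Δ̃(y)` (`g ≥ 0`), then
`‖ζu‖² ≤ |ζ|²·Σ_i g(i)²`. [cite: Balaban1984PropagatorsI, Prop. 1.2 (1.114) p.36 (the factor |ζ|, supp ζ ⊂ Δ̃(y))] -/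
theorem nsq_smulV_le_of_majorant {ζ : Tor (fine n M) → ℝ} {y : Tor M} (hζ : cutInL n M ζ y)
    (u : Tor (fine n M) × Fin d → ℂ) (g : Tor (fine n M) × Fin d → ℝ) (hg0 : ∀ i, 0 ≤ g i)
    (hg : ∀ i, i.1 ∈ cubeT n M y → ‖u i‖ ≤ g i) :
    nsq (smulV n M ζ u) ≤ cutSupL n M ζ ^ 2 * ∑ i, g i ^ 2 := by
  unfold nsq
  rw [Finset.mul_sum]
  refine Finset.sum_le_sum fun i _ => ?_
  have hζ0 : 0 ≤ cutSupL n M ζ := cutSupL_nonneg ζ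
  by_cases h0 : ζ i.1 = 0
  · have hz : ‖smulV n M ζ u i‖ = 0 := by simp only [smulV, h0, Complex.ofReal_zero, zero_mul, norm_zero]
    rw [hz, sq, zero_mul]
    have := hg0 i; positivity
  · have hi : i.1 ∈ cubeT n M y := hζ i.1 h0
    have h1 : ‖smulV n M ζ u i‖ = |ζ i.1| * ‖u i‖ := by
      simp only [smulV, norm_mul, Complex.norm_real, Real.norm_eq_abs]
    have h2 : |ζ i.1| ≤ cutSupL n M ζ := by
      have := norm_le_supNorm ζ (Finset.mem_univ i.1)
      rw [Real.norm_eq_abs] at this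
      exact this
    rw [h1]
    have h3 : |ζ i.1| * ‖u i‖ ≤ cutSupL n M ζ * g i :=
      mul_le_mul h2 (hg i hi) (norm_nonneg _) hζ0
    calc (|ζ i.1| * ‖u i‖) ^ 2 ≤ (cutSupL n M ζ * g i) ^ 2 := pow_le_pow_left₀ (by positivity) h3 2
      _ = cutSupL n M ζ ^ 2 * g i ^ 2 := by ring

omit [NeZero n] hM in
/-- `smulT ζ F ν = smulV ζ (F ν)`. [cite: Balaban1984PropagatorsI, Prop. 1.2 (1.111) p.35 (ζ∇GJ)] -/
theorem smulT_apply (ζ : Tor (fine n M) → ℝ) {S : Type*} (F : S → Tor (fine n M) × Fin d → ℂ) (s : S) :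
    smulT n M ζ F s = smulV n M ζ (F s) := rfl

/-! ## §2 The unweighting on the observation cube `Δ̃(y)` -/

/-- `‖v(i)‖ ≤ e^{2δ}e^{−δ|y−y₁|}‖w(i)‖` on `Δ̃(y)` for `w = e^{δρ_{y₁}}v`. [cite: Balaban1984PropagatorsI, Prop. 1.2 (1.114) p.36 (e^{−δ₀|y−y′|})] -/
theorem norm_le_on_cube (hn : 1 ≤ n) {δ : ℝ} (hδ0 : 0 ≤ δ) (y₁ : Tor M) {y : Tor M} (v : Tor (fine n M) × Fin d → ℂ)
    {i : Tor (fine n M) × Fin d} (hi : i.1 ∈ cubeT n M y) :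
    ‖v i‖ ≤ Real.exp (2 * δ) * Real.exp (-(δ * distSite M y y₁)) * ‖wmul n M (wt n M δ (rho n M y₁)) v i‖ := by
  rw [norm_eq_wt_neg_mul n M δ (rho n M y₁) v i]
  exact mul_le_mul_of_nonneg_right (wt_neg_le_of_mem_cubeT n M hn hδ0 hi y₁) (norm_nonneg _)

/-- `‖∇_νv(i)‖ ≤ 3e^{2δ}e^{−δ|y−y₁|}(‖∇_νw(i)‖ + ‖w(i)‖)` on `Δ̃(y)` for `w = e^{δρ_{y₁}}v`, `0 ≤ δ ≤ 1` (product rule).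
[cite: Balaban1984PropagatorsI, Prop. 1.2 (1.114) p.36 (ζ∇GJ), (1.121) p.37] -/
theorem norm_fdiff_le_on_cube (hn : 1 ≤ n) {δ : ℝ} (hδ0 : 0 ≤ δ) (hδ1 : δ ≤ 1) (y₁ : Tor M) {y : Tor M}
    (v : Tor (fine n M) × Fin d → ℂ) (ν : Fin d) {i : Tor (fine n M) × Fin d} (hi : i.1 ∈ cubeT n M y) :
    ‖(fdiff (fine n M) (n : ℂ) ν *ᵥ v) i‖
      ≤ 3 * (Real.exp (2 * δ) * Real.exp (-(δ * distSite M y y₁))) *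
        (‖(fdiff (fine n M) (n : ℂ) ν *ᵥ wmul n M (wt n M δ (rho n M y₁)) v) i‖
          + ‖wmul n M (wt n M δ (rho n M y₁)) v i‖) := by
  set w := wmul n M (wt n M δ (rho n M y₁)) v with hw
  have hv : v = wmul n M (wt n M (-δ) (rho n M y₁)) w := by rw [hw, wmul_neg_wmul]
  have habs : |(-δ)| ≤ 1 := by rw [abs_neg, abs_of_nonneg hδ0]; exact hδ1
  have h1 := norm_fdiff_wmul_le n M (abs_rho_sub_rho_le n M y₁) habs w ν i
  rw [← hv] at h1
  refine h1.trans ?_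
  have hE1 := wt_neg_nb_le_of_mem_cubeT n M hn hδ0 hδ1 hi y₁ ν
  have hE0 := wt_neg_le_of_mem_cubeT n M hn hδ0 hi y₁
  have hA := norm_nonneg ((fdiff (fine n M) (n : ℂ) ν *ᵥ w) i)
  have hB := norm_nonneg (w i)
  have hX : 0 ≤ Real.exp (2 * δ) * Real.exp (-(δ * distSite M y y₁)) := by positivity
  have hW0 : 0 ≤ wt n M (-δ) (rho n M y₁) i.1 := (wt_pos n M (-δ) (rho n M y₁) i.1).le
  rw [abs_neg, abs_of_nonneg hδ0]
  unfold nb at hE1 ⊢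
  calc wt n M (-δ) (rho n M y₁) (i.1 + unitVec (fine n M) ν) * ‖(fdiff (fine n M) (n : ℂ) ν *ᵥ w) i‖
        + 2 * δ * wt n M (-δ) (rho n M y₁) i.1 * ‖w i‖
      ≤ 3 * (Real.exp (2 * δ) * Real.exp (-(δ * distSite M y y₁))) * ‖(fdiff (fine n M) (n : ℂ) ν *ᵥ w) i‖
        + 2 * 1 * (Real.exp (2 * δ) * Real.exp (-(δ * distSite M y y₁))) * ‖w i‖ := by
        gcongr
    _ ≤ _ := by nlinarith

/-! ## §3 The entries m = 0, 1 (source `J` a vector field over `Δ̃(y′)`) -/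

/-- **(1.114), ENTRY `‖ζGJ‖`** for `G = Δ_a⁻¹` on the lattice torus of record, UNDER (1.126):
`‖ζGJ‖ ≤ e^{2δ}(2e^δ/γ₀)·e^{−δ|y−y′|}·|ζ|·‖J‖` for `supp ζ ⊂ Δ̃(y)`, `supp J ⊂ Δ̃(y′)`, `0 ≤ δ ≤ δ₁`.
[cite: Balaban1984PropagatorsI, Prop. 1.2 (1.114) p.36, p.39; proof ours by the p.36 route] -/
theorem l2_smulV_G_le (hn : 1 ≤ n) {a : ℝ} (ha : 0 < a) {δ' C : ℝ} (hδ' : 0 < δ') (hC : 0 ≤ C)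
    (h126 : ∀ i j, ‖dPd n M i j‖ ≤ C * ((n : ℝ) ^ d)⁻¹ * Real.exp (-(δ' * distU n M i.1 j.1)))
    {δ : ℝ} (hδ0 : 0 ≤ δ) (hδ : δ ≤ delta1 d a δ' C) {ζ : Tor (fine n M) → ℝ} {y y' : Tor M} (hζ : cutInL n M ζ y)
    {J : Tor (fine n M) × Fin d → ℂ} (hJ : ∀ i, J i ≠ 0 → i.1 ∈ cubeT n M y') :
    l2 (smulV n M ζ ((DeltaA n M a)⁻¹ *ᵥ J))
      ≤ Real.exp (2 * δ) * (2 * Real.exp δ / gammaZero d a) * Real.exp (-(δ * distSite M y y'))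
        * cutSupL n M ζ * l2 J := by
  set v := (DeltaA n M a)⁻¹ *ᵥ J with hv
  set w := wmul n M (wt n M δ (rho n M y')) v with hw
  have hS := solve_bound n M hn ha hδ' hC h126 hδ0 hδ hJ (DeltaA_mulVec_G n M hn ha J)
  rw [← hv] at hS
  set K := Real.exp (2 * δ) * Real.exp (-(δ * distSite M y y')) with hK
  have hK0 : 0 ≤ K := by positivity
  clear_value K
  have hmaj := nsq_smulV_le_of_majorant n M hζ v (fun i => K * ‖w i‖) (fun i => mul_nonneg hK0 (norm_nonneg _))
    (fun i hi => by rw [hK]; exact norm_le_on_cube n M hn hδ0 y' v hi)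
  have hsum : ∑ i, (K * ‖w i‖) ^ 2 = K ^ 2 * nsq w := by
    unfold nsq; rw [Finset.mul_sum]; refine Finset.sum_congr rfl fun i _ => ?_; ring
  rw [hsum] at hmaj
  have hwS : nsq w ≤ (2 * Real.exp δ / gammaZero d a) ^ 2 * nsq J :=
    (le_add_of_nonneg_left (Finset.sum_nonneg fun _ _ => nsq_nonneg _)).trans hS
  have hγ := gammaZero_pos d a
  have hζ0 : 0 ≤ cutSupL n M ζ := cutSupL_nonneg ζ
  have h1 : nsq (smulV n M ζ v) ≤ (K * (2 * Real.exp δ / gammaZero d a) * cutSupL n M ζ) ^ 2 * nsq J := by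
    calc nsq (smulV n M ζ v) ≤ cutSupL n M ζ ^ 2 * (K ^ 2 * nsq w) := hmaj
      _ ≤ cutSupL n M ζ ^ 2 * (K ^ 2 * ((2 * Real.exp δ / gammaZero d a) ^ 2 * nsq J)) := by gcongr
      _ = _ := by ring
  unfold l2
  calc Real.sqrt (nsq (smulV n M ζ v)) ≤ Real.sqrt ((K * (2 * Real.exp δ / gammaZero d a) * cutSupL n M ζ) ^ 2 * nsq J) :=
        Real.sqrt_le_sqrt h1
    _ = K * (2 * Real.exp δ / gammaZero d a) * cutSupL n M ζ * Real.sqrt (nsq J) := by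
        rw [Real.sqrt_mul (sq_nonneg _), Real.sqrt_sq (mul_nonneg (mul_nonneg hK0 (by positivity)) hζ0)]
    _ = _ := by rw [hK]; ring

/-- the weighted sum for the gradient entries: `Σ_ν Σ_i (3K(‖∇_νw(i)‖ + ‖w(i)‖))² ≤ 18K²(d+1)·(Σ_ν‖∇_νw‖² + ‖w‖²)`.
[cite: Balaban1984PropagatorsI, Prop. 1.2 (1.114) p.36 (ζ∇GJ; the constant)] -/
theorem sum_grad_majorant_le (K : ℝ) (w : Tor (fine n M) × Fin d → ℂ) :
    ∑ ν : Fin d, ∑ i, (3 * K * (‖(fdiff (fine n M) (n : ℂ) ν *ᵥ w) i‖ + ‖w i‖)) ^ 2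
      ≤ 18 * K ^ 2 * (d + 1) * (∑ ν, nsq (fdiff (fine n M) (n : ℂ) ν *ᵥ w) + nsq w) := by
  have hpt : ∀ ν i, (3 * K * (‖(fdiff (fine n M) (n : ℂ) ν *ᵥ w) i‖ + ‖w i‖)) ^ 2
      ≤ 18 * K ^ 2 * (‖(fdiff (fine n M) (n : ℂ) ν *ᵥ w) i‖ ^ 2 + ‖w i‖ ^ 2) := by
    intro ν i
    nlinarith [sq_nonneg (‖(fdiff (fine n M) (n : ℂ) ν *ᵥ w) i‖ - ‖w i‖), sq_nonneg K]
  have h1 : ∀ ν, ∑ i, (3 * K * (‖(fdiff (fine n M) (n : ℂ) ν *ᵥ w) i‖ + ‖w i‖)) ^ 2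
      ≤ 18 * K ^ 2 * (nsq (fdiff (fine n M) (n : ℂ) ν *ᵥ w) + nsq w) := by
    intro ν
    refine (Finset.sum_le_sum fun i _ => hpt ν i).trans (le_of_eq ?_)
    unfold nsq
    rw [← Finset.mul_sum, Finset.sum_add_distrib]
  refine (Finset.sum_le_sum fun ν _ => h1 ν).trans ?_
  rw [← Finset.mul_sum, Finset.sum_add_distrib, Finset.sum_const, Finset.card_univ, Fintype.card_fin, nsmul_eq_mul]
  have hw := nsq_nonneg w
  have hs := Finset.sum_nonneg fun ν (_ : ν ∈ Finset.univ) => nsq_nonneg (fdiff (fine n M) (n : ℂ) ν *ᵥ w)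
  have hd : (0 : ℝ) ≤ d := Nat.cast_nonneg d
  have hin : ∑ ν, nsq (fdiff (fine n M) (n : ℂ) ν *ᵥ w) + (d : ℝ) * nsq w
      ≤ (d + 1) * (∑ ν, nsq (fdiff (fine n M) (n : ℂ) ν *ᵥ w) + nsq w) := by nlinarith
  have hK2 : 0 ≤ 18 * K ^ 2 := by positivity
  calc 18 * K ^ 2 * (∑ ν, nsq (fdiff (fine n M) (n : ℂ) ν *ᵥ w) + (d : ℝ) * nsq w)
      ≤ 18 * K ^ 2 * ((d + 1) * (∑ ν, nsq (fdiff (fine n M) (n : ℂ) ν *ᵥ w) + nsq w)) := mul_le_mul_of_nonneg_left hin hK2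
    _ = _ := by ring

/-- **(1.114), ENTRY `‖ζ∇GJ‖`** UNDER (1.126): `‖ζ∇GJ‖ ≤ 3e^{2δ}√(18(d+1))(2e^δ/γ₀)·e^{−δ|y−y′|}|ζ|‖J‖`, `0 ≤ δ ≤ δ₁`.
[cite: Balaban1984PropagatorsI, Prop. 1.2 (1.114) p.36, p.39; proof ours by the p.36 route] -/
theorem l2T_smulT_gradG_le (hn : 1 ≤ n) {a : ℝ} (ha : 0 < a) {δ' C : ℝ} (hδ' : 0 < δ') (hC : 0 ≤ C)
    (h126 : ∀ i j, ‖dPd n M i j‖ ≤ C * ((n : ℝ) ^ d)⁻¹ * Real.exp (-(δ' * distU n M i.1 j.1)))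
    {δ : ℝ} (hδ0 : 0 ≤ δ) (hδ : δ ≤ delta1 d a δ' C) {ζ : Tor (fine n M) → ℝ} {y y' : Tor M} (hζ : cutInL n M ζ y)
    {J : Tor (fine n M) × Fin d → ℂ} (hJ : ∀ i, J i ≠ 0 → i.1 ∈ cubeT n M y') :
    l2T (smulT n M ζ (grad n M ((DeltaA n M a)⁻¹ *ᵥ J)))
      ≤ Real.sqrt (18 * (d + 1)) * Real.exp (2 * δ) * (2 * Real.exp δ / gammaZero d a)
        * Real.exp (-(δ * distSite M y y')) * cutSupL n M ζ * l2 J := by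
  obtain ⟨hδ1, -, -⟩ := delta1_spec (d := d) ha hδ' hC hδ
  set v := (DeltaA n M a)⁻¹ *ᵥ J with hv
  set w := wmul n M (wt n M δ (rho n M y')) v with hw
  have hS := solve_bound n M hn ha hδ' hC h126 hδ0 hδ hJ (DeltaA_mulVec_G n M hn ha J)
  rw [← hv] at hS
  set S := ∑ ν, nsq (fdiff (fine n M) (n : ℂ) ν *ᵥ w) + nsq w with hSdef
  have hS0 : 0 ≤ S := add_nonneg (Finset.sum_nonneg fun _ _ => nsq_nonneg _) (nsq_nonneg _)
  set K := Real.exp (2 * δ) * Real.exp (-(δ * distSite M y y')) with hK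
  have hK0 : 0 ≤ K := by positivity
  clear_value K
  have hζ0 : 0 ≤ cutSupL n M ζ := cutSupL_nonneg ζ
  -- the sum of squares over directions
  have hsq : l2T (smulT n M ζ (grad n M v)) ^ 2 ≤ cutSupL n M ζ ^ 2 * (18 * K ^ 2 * (d + 1) * S) := by
    rw [B5Prop11Lattice.l2T_sq]
    have h1 : ∀ ν, nsq (smulT n M ζ (grad n M v) ν)
        ≤ cutSupL n M ζ ^ 2 * ∑ i, (3 * K * (‖(fdiff (fine n M) (n : ℂ) ν *ᵥ w) i‖ + ‖w i‖)) ^ 2 := by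
      intro ν
      rw [smulT_apply]
      exact nsq_smulV_le_of_majorant n M hζ _ _
        (fun i => mul_nonneg (mul_nonneg (by norm_num) hK0) (add_nonneg (norm_nonneg _) (norm_nonneg _)))
        (fun i hi => by rw [hK]; exact norm_fdiff_le_on_cube n M hn hδ0 hδ1 y' v ν hi)
    refine (Finset.sum_le_sum fun ν _ => h1 ν).trans ?_
    rw [← Finset.mul_sum]
    exact mul_le_mul_of_nonneg_left (sum_grad_majorant_le n M K w) (sq_nonneg _)
  have hγ := gammaZero_pos d a
  have h2 : l2T (smulT n M ζ (grad n M v)) ^ 2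
      ≤ (Real.sqrt (18 * (d + 1)) * K * (2 * Real.exp δ / gammaZero d a) * cutSupL n M ζ) ^ 2 * nsq J := by
    have e : (Real.sqrt (18 * (d + 1)) * K * (2 * Real.exp δ / gammaZero d a) * cutSupL n M ζ) ^ 2 * nsq J
        = cutSupL n M ζ ^ 2 * (18 * K ^ 2 * (d + 1) * ((2 * Real.exp δ / gammaZero d a) ^ 2 * nsq J)) := by
      rw [mul_pow, mul_pow, mul_pow, Real.sq_sqrt (by positivity)]; ring
    rw [e]
    refine hsq.trans ?_
    gcongr
  have h3 := Real.sqrt_le_sqrt h2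
  have hnn : 0 ≤ Real.sqrt (18 * (d + 1)) * K * (2 * Real.exp δ / gammaZero d a) * cutSupL n M ζ :=
    mul_nonneg (mul_nonneg (mul_nonneg (Real.sqrt_nonneg _) hK0) (by positivity)) hζ0
  rw [Real.sqrt_sq (l2T_nonneg _), Real.sqrt_mul (sq_nonneg _), Real.sqrt_sq hnn] at h3
  unfold l2
  calc l2T (smulT n M ζ (grad n M v))
      ≤ Real.sqrt (18 * (d + 1)) * K * (2 * Real.exp δ / gammaZero d a) * cutSupL n M ζ * Real.sqrt (nsq J) := h3
    _ = _ := by rw [hK]; ring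

/-! ## §4 The entries m = 2, 3 (divergence source `∇*T`, `T` a tensor field over `Δ̃(y′)`) -/

/-- `∇*T = Σ_ν ∇_ν^* T_ν` with `∇_ν^*` written as a conjugate transpose. [cite: Balaban1984PropagatorsI, (1.89) p.33 (G∇*J)] -/
theorem divT_eq_sum_conjTranspose (T : Fin d → Tor (fine n M) × Fin d → ℂ) :
    divT n M T = ∑ ν, (fdiff (fine n M) (n : ℂ) ν)ᴴ *ᵥ T ν := by
  unfold divT; rfl

/-- **(1.114), ENTRY `‖ζG∇*J‖`** UNDER (1.126): `‖ζG∇*T‖ ≤ e^{2δ}·√(72(d+1))e^δ/γ₀·e^{−δ|y−y′|}|ζ|‖T‖`, `0 ≤ δ ≤ δ₁`.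
[cite: Balaban1984PropagatorsI, Prop. 1.2 (1.114) p.36, p.39; proof ours by the p.36 route] -/
theorem l2_smulV_GdivT_le (hn : 1 ≤ n) {a : ℝ} (ha : 0 < a) {δ' C : ℝ} (hδ' : 0 < δ') (hC : 0 ≤ C)
    (h126 : ∀ i j, ‖dPd n M i j‖ ≤ C * ((n : ℝ) ^ d)⁻¹ * Real.exp (-(δ' * distU n M i.1 j.1)))
    {δ : ℝ} (hδ0 : 0 ≤ δ) (hδ : δ ≤ delta1 d a δ' C) {ζ : Tor (fine n M) → ℝ} {y y' : Tor M} (hζ : cutInL n M ζ y)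
    {T : Fin d → Tor (fine n M) × Fin d → ℂ} (hT : ∀ ν i, T ν i ≠ 0 → i.1 ∈ cubeT n M y') :
    l2 (smulV n M ζ ((DeltaA n M a)⁻¹ *ᵥ divT n M T))
      ≤ Real.exp (2 * δ) * Real.sqrt (72 * (d + 1) * Real.exp (2 * δ) / gammaZero d a ^ 2)
        * Real.exp (-(δ * distSite M y y')) * cutSupL n M ζ * l2T T := by
  set v := (DeltaA n M a)⁻¹ *ᵥ divT n M T with hv
  set w := wmul n M (wt n M δ (rho n M y')) v with hw
  have hsol : DeltaA n M a *ᵥ v = ∑ ν, (fdiff (fine n M) (n : ℂ) ν)ᴴ *ᵥ T ν := by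
    rw [hv, DeltaA_mulVec_G n M hn ha, divT_eq_sum_conjTranspose]
  have hS := solveDiv_bound n M hn ha hδ' hC h126 hδ0 hδ hT hsol
  set CD := 72 * (d + 1) * Real.exp (2 * δ) / gammaZero d a ^ 2 with hCD
  have hCD0 : 0 ≤ CD := by have := gammaZero_pos d a; positivity
  clear_value CD
  set K := Real.exp (2 * δ) * Real.exp (-(δ * distSite M y y')) with hK
  have hK0 : 0 ≤ K := by positivity
  clear_value K
  have hmaj := nsq_smulV_le_of_majorant n M hζ v (fun i => K * ‖w i‖) (fun i => mul_nonneg hK0 (norm_nonneg _))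
    (fun i hi => by rw [hK]; exact norm_le_on_cube n M hn hδ0 y' v hi)
  have hsum : ∑ i, (K * ‖w i‖) ^ 2 = K ^ 2 * nsq w := by
    unfold nsq; rw [Finset.mul_sum]; refine Finset.sum_congr rfl fun i _ => ?_; ring
  rw [hsum] at hmaj
  have hF : 0 ≤ ∑ ν, nsq (T ν) := Finset.sum_nonneg fun _ _ => nsq_nonneg _
  have hwS : nsq w ≤ CD * ∑ ν, nsq (T ν) :=
    (le_add_of_nonneg_left (Finset.sum_nonneg fun _ _ => nsq_nonneg _)).trans hS
  have hζ0 : 0 ≤ cutSupL n M ζ := cutSupL_nonneg ζ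
  have h1 : nsq (smulV n M ζ v) ≤ (K * Real.sqrt CD * cutSupL n M ζ) ^ 2 * ∑ ν, nsq (T ν) := by
    calc nsq (smulV n M ζ v) ≤ cutSupL n M ζ ^ 2 * (K ^ 2 * nsq w) := hmaj
      _ ≤ cutSupL n M ζ ^ 2 * (K ^ 2 * (CD * ∑ ν, nsq (T ν))) := by gcongr
      _ = _ := by
          have hs : Real.sqrt CD ^ 2 = CD := Real.sq_sqrt hCD0
          rw [mul_pow, mul_pow, hs]; ring
  unfold l2 l2T
  calc Real.sqrt (nsq (smulV n M ζ v)) ≤ Real.sqrt ((K * Real.sqrt CD * cutSupL n M ζ) ^ 2 * ∑ ν, nsq (T ν)) :=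
        Real.sqrt_le_sqrt h1
    _ = K * Real.sqrt CD * cutSupL n M ζ * Real.sqrt (∑ ν, nsq (T ν)) := by
        rw [Real.sqrt_mul (sq_nonneg _), Real.sqrt_sq (mul_nonneg (mul_nonneg hK0 (Real.sqrt_nonneg _)) hζ0)]
    _ = _ := by rw [hK]; ring

/-- **(1.114), ENTRY `‖ζ∇G∇*J‖`** UNDER (1.126): `‖ζ∇G∇*T‖ ≤ √(18(d+1))e^{2δ}·√(72(d+1)e^{2δ}/γ₀²)·e^{−δ|y−y′|}|ζ|‖T‖`.
[cite: Balaban1984PropagatorsI, Prop. 1.2 (1.114) p.36, p.39; proof ours by the p.36 route] -/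
theorem l2T_smulT_gradGdivT_le (hn : 1 ≤ n) {a : ℝ} (ha : 0 < a) {δ' C : ℝ} (hδ' : 0 < δ') (hC : 0 ≤ C)
    (h126 : ∀ i j, ‖dPd n M i j‖ ≤ C * ((n : ℝ) ^ d)⁻¹ * Real.exp (-(δ' * distU n M i.1 j.1)))
    {δ : ℝ} (hδ0 : 0 ≤ δ) (hδ : δ ≤ delta1 d a δ' C) {ζ : Tor (fine n M) → ℝ} {y y' : Tor M} (hζ : cutInL n M ζ y)
    {T : Fin d → Tor (fine n M) × Fin d → ℂ} (hT : ∀ ν i, T ν i ≠ 0 → i.1 ∈ cubeT n M y') :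
    l2T (smulT n M ζ (grad n M ((DeltaA n M a)⁻¹ *ᵥ divT n M T)))
      ≤ Real.sqrt (18 * (d + 1)) * Real.exp (2 * δ) * Real.sqrt (72 * (d + 1) * Real.exp (2 * δ) / gammaZero d a ^ 2)
        * Real.exp (-(δ * distSite M y y')) * cutSupL n M ζ * l2T T := by
  obtain ⟨hδ1, -, -⟩ := delta1_spec (d := d) ha hδ' hC hδ
  set v := (DeltaA n M a)⁻¹ *ᵥ divT n M T with hv
  set w := wmul n M (wt n M δ (rho n M y')) v with hw
  have hsol : DeltaA n M a *ᵥ v = ∑ ν, (fdiff (fine n M) (n : ℂ) ν)ᴴ *ᵥ T ν := by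
    rw [hv, DeltaA_mulVec_G n M hn ha, divT_eq_sum_conjTranspose]
  have hS := solveDiv_bound n M hn ha hδ' hC h126 hδ0 hδ hT hsol
  set S := ∑ ν, nsq (fdiff (fine n M) (n : ℂ) ν *ᵥ w) + nsq w with hSdef
  have hS0 : 0 ≤ S := add_nonneg (Finset.sum_nonneg fun _ _ => nsq_nonneg _) (nsq_nonneg _)
  set CD := 72 * (d + 1) * Real.exp (2 * δ) / gammaZero d a ^ 2 with hCD
  have hCD0 : 0 ≤ CD := by have := gammaZero_pos d a; positivity
  clear_value CD
  set K := Real.exp (2 * δ) * Real.exp (-(δ * distSite M y y')) with hK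
  have hK0 : 0 ≤ K := by positivity
  clear_value K
  have hζ0 : 0 ≤ cutSupL n M ζ := cutSupL_nonneg ζ
  have hF : 0 ≤ ∑ ν, nsq (T ν) := Finset.sum_nonneg fun _ _ => nsq_nonneg _
  have hsq : l2T (smulT n M ζ (grad n M v)) ^ 2 ≤ cutSupL n M ζ ^ 2 * (18 * K ^ 2 * (d + 1) * S) := by
    rw [B5Prop11Lattice.l2T_sq]
    have h1 : ∀ ν, nsq (smulT n M ζ (grad n M v) ν)
        ≤ cutSupL n M ζ ^ 2 * ∑ i, (3 * K * (‖(fdiff (fine n M) (n : ℂ) ν *ᵥ w) i‖ + ‖w i‖)) ^ 2 := by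
      intro ν
      rw [smulT_apply]
      exact nsq_smulV_le_of_majorant n M hζ _ _
        (fun i => mul_nonneg (mul_nonneg (by norm_num) hK0) (add_nonneg (norm_nonneg _) (norm_nonneg _)))
        (fun i hi => by rw [hK]; exact norm_fdiff_le_on_cube n M hn hδ0 hδ1 y' v ν hi)
    refine (Finset.sum_le_sum fun ν _ => h1 ν).trans ?_
    rw [← Finset.mul_sum]
    exact mul_le_mul_of_nonneg_left (sum_grad_majorant_le n M K w) (sq_nonneg _)
  have h2 : l2T (smulT n M ζ (grad n M v)) ^ 2
      ≤ (Real.sqrt (18 * (d + 1)) * K * Real.sqrt CD * cutSupL n M ζ) ^ 2 * ∑ ν, nsq (T ν) := by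
    have e : (Real.sqrt (18 * (d + 1)) * K * Real.sqrt CD * cutSupL n M ζ) ^ 2 * ∑ ν, nsq (T ν)
        = cutSupL n M ζ ^ 2 * (18 * K ^ 2 * (d + 1) * (CD * ∑ ν, nsq (T ν))) := by
      have hs1 : Real.sqrt (18 * (d + 1)) ^ 2 = 18 * (d + 1) := Real.sq_sqrt (by positivity)
      have hs2 : Real.sqrt CD ^ 2 = CD := Real.sq_sqrt hCD0
      rw [mul_pow, mul_pow, mul_pow, hs1, hs2]; ring
    rw [e]
    refine hsq.trans ?_
    gcongr
  have h3 := Real.sqrt_le_sqrt h2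
  have hnn : 0 ≤ Real.sqrt (18 * (d + 1)) * K * Real.sqrt CD * cutSupL n M ζ :=
    mul_nonneg (mul_nonneg (mul_nonneg (Real.sqrt_nonneg _) hK0) (Real.sqrt_nonneg _)) hζ0
  rw [Real.sqrt_sq (l2T_nonneg _), Real.sqrt_mul (sq_nonneg _), Real.sqrt_sq hnn] at h3
  unfold l2T
  calc l2T (smulT n M ζ (grad n M v))
      ≤ Real.sqrt (18 * (d + 1)) * K * Real.sqrt CD * cutSupL n M ζ * Real.sqrt (∑ ν, nsq (T ν)) := h3
    _ = _ := by rw [hK]; ring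

end

end Literature.MathematicalPhysics.QuantumFieldTheory.Balaban1983to89.B5Local114GLatticeFirst
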